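import Mathlib
import HarnessLib
import Literature.MathematicalPhysics.QuantumLattice.FermiRG.Salmhofer1998VolumeImprovementProof
import Summits.HubbardSuperconductivity.HubbardSuperconductivity.Theorems.KLProgrammeFermiSurfaceTwoShellTube
import Summits.HubbardSuperconductivity.HubbardSuperconductivity.Theorems.KLProgrammeFermiSurfaceTwoLoopAngular
import Summits.HubbardSuperconductivity.HubbardSuperconductivity.Theorems.KLProgrammeFermiSurfaceSalmhofer1998

/-!
# Salmhofer 1998 Lemma 6/(6.11) for the Hubbard band, part 2a: the measure-theoretic CORE of the two-shell volume bound
# (two polar tubes with an angular constraint; one shell's area; the sign dictionary)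

Cell `gate-hubbard-kl`, seat p4 (C5a lead), g8; t7's CONSUMER HOOK (typer t7 g11, `Salmhofer1998VolumeImprovementProof`: Lemma 7 (6.9)
PROVED modulo the one geometric HYP predicate `TwoShellVolumeBound M V` = print's (6.11)→(6.12) with Lemma 6 inserted).  For the Hubbard
datum `M_μ = (ε = 1, E = ε(𝐩) - μ, v̂ ≡ U, k₀, ε₀)` of fs-1's `klfs_sal98_hyp` we PROVE `∃ V, TwoShellVolumeBound M_μ V` with ONE `V` on
every compact level range `μ ∈ [a, b] ⊂ (-4, 0)`, all `U`, `k₀`, `0 < ε₀ ≤ 1` (**`kltsv_exists_twoShellVolumeBound`**), exactly along print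
p.22 L174 – p.23 L21: both shells are polar tubes of radial half-width `√2ε_j/Dt_min` about the curve (part 1, `kltsv_radius_sub_le`);
moving each momentum to the curve point at its own angle displaces the third band by `≤ 8ε/Dt_min` (`|∇ε| ≤ 2` coordinatewise,
`kltsv_abs_sqDispersion_sub_le`), so the constraint becomes the ANGULAR one at thickness `(1 + 8/Dt_min)ε`; the product of the two tube
measures pushed to the angles is dominated by `(π+δ)²(2δ₁)(2δ₂)·dθ₁dθ₂` (part 1, `kltsv_map_arg_restrict_tube_le`, `Measure.prod_mono`);
and the remaining iterated angular integral is fs-1's **`kltl_exists_angular_bound`** (FST II Theorem 1.1 for the band, `Q ε|log ε|`, umklapp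
included).  Large `ε` (above a threshold fixed by the window) is absorbed by the product of the two shell areas (`kltsv_shell_volume_le`).

* `kltsv_abs_sqDispersion_sub_le`, `kltsv_sign_cases`, `kltsv_constraint_dictionary` (evenness: signs `(v₁,v₂) ↦ τ = -v₁v₂`, `q ↦ -v₂q`);
* `kltsv_volume_le_angular` — the measure-theoretic core: a set of momentum pairs whose members lie in the two tubes with angle pair in a
  measurable `Ang ⊆ ℝ²` has volume `≤ (π+δ₁)(2δ₁)·(π+δ₂)(2δ₂)·∫_{(-π,π)} dθ₁ vol{θ₂ ∈ (-π,π) : (θ₁,θ₂) ∈ Ang}`;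
* `kltsv_shell_volume_le` — one shell has area `≤ (π+δ)(2δ)(2π)`, `δ = √2η/Dt_min`.

The assembly (`kltsv_exists_twoShellVolumeBound`, `kltsv_loopBoundsHold_hubbard`) is part 2b, `…TwoShellVolume.lean`.
Everything is proved; no definitions, no named facts. [cite: Salmhofer1998, Lemma 6 (p.22 L46–62), Lemma 7 proof (6.11)–(6.12) (p.22 L173 – p.23 L21)]
-/

noncomputable section

open Real Set MeasureTheory
open scoped ENNReal

-- the tree's namespace `Summit.<Summit>.<Problem>.Theorems` repeats the summit name by design (D-0017)
set_option linter.dupNamespace false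

namespace Summit.HubbardSuperconductivity.HubbardSuperconductivity.Theorems

open Literature.MathematicalPhysics.QuantumLattice
open Literature.MathematicalPhysics.QuantumLattice.BandSectorCounting
open Literature.MathematicalPhysics.QuantumLattice.FermiRG
open Literature.MathematicalPhysics.QuantumLattice.FermiRG.Salmhofer1998

/-! ### §1 Elementary inputs: Lipschitz displacement, signs, the angular dictionary, a logarithm -/

/-- `|ε(x) - ε(y)| ≤ 2(|x₀ - y₀| + |x₁ - y₁|)` (`|cos' | ≤ 1`). [folklore] -/
theorem kltsv_abs_sqDispersion_sub_le (x y : Fin 2 → ℝ) :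
    |sqDispersion x - sqDispersion y| ≤ 2 * (|x 0 - y 0| + |x 1 - y 1|) := by
  have h0 := Real.abs_cos_sub_cos_le (x 0) (y 0)
  have h1 := Real.abs_cos_sub_cos_le (x 1) (y 1)
  have h : sqDispersion x - sqDispersion y = -2 * ((Real.cos (x 0) - Real.cos (y 0)) + (Real.cos (x 1) - Real.cos (y 1))) := by
    simp only [sqDispersion]; ring
  rw [h, abs_mul, show |(-2 : ℝ)| = 2 by norm_num]
  exact mul_le_mul_of_nonneg_left ((abs_add_le _ _).trans (add_le_add h0 h1)) (by norm_num)

/-- A Boolean sign is `±1`. [folklore] -/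
theorem kltsv_sign_cases (v : Bool) : (if v then (1 : ℝ) else -1) = 1 ∨ (if v then (1 : ℝ) else -1) = -1 := by
  cases v <;> simp

/-- **The angular dictionary**: with the curve points `p_μ(θ) = (X(θ), Y(θ))`,
`ε(v₁p_μ(θ₁) + v₂p_μ(θ₂) + q) = ε₂(X(θ₂) - (τX(θ₁) + q'₁), Y(θ₂) - (τY(θ₁) + q'₂))` with `τ = -v₁v₂`, `q' = -v₂q` (`v₂ = ±1`; evenness of
`ε₂`). [cite: Salmhofer1998, Lemma 6 (p.22 L54–60)] -/
theorem kltsv_constraint_dictionary (μ : ℝ) (v₁ : ℝ) {v₂ : ℝ} (hv₂ : v₂ = 1 ∨ v₂ = -1) (q : Fin 2 → ℝ) (θ₁ θ₂ : ℝ) :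
    sqDispersion (v₁ • (![bandX μ θ₁, bandY μ θ₁] : Fin 2 → ℝ) + v₂ • (![bandX μ θ₂, bandY μ θ₂] : Fin 2 → ℝ) + q) =
      eps2 (bandX μ θ₂ - (-(v₁ * v₂) * bandX μ θ₁ + -(v₂ * q 0))) (bandY μ θ₂ - (-(v₁ * v₂) * bandY μ θ₁ + -(v₂ * q 1))) := by
  rw [sqDispersion_eq_eps2]
  simp only [Pi.add_apply, Pi.smul_apply, smul_eq_mul, Matrix.cons_val_zero, Matrix.cons_val_one]
  rcases hv₂ with rfl | rfl
  · congr 1 <;> ring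
  · rw [show v₁ * bandX μ θ₁ + -1 * bandX μ θ₂ + q 0 = -(bandX μ θ₂ - (-(v₁ * -1) * bandX μ θ₁ + -(-1 * q 0))) by ring,
      show v₁ * bandY μ θ₁ + -1 * bandY μ θ₂ + q 1 = -(bandY μ θ₂ - (-(v₁ * -1) * bandY μ θ₁ + -(-1 * q 1))) by ring, eps2_neg]

/-- `|log(Cε)| ≤ (1 + log C)(1 + |log ε|)` for `C ≥ 1`, `0 < ε`. [folklore] -/
theorem kltsv_abs_log_mul_le {C ε : ℝ} (hC : 1 ≤ C) (hε : 0 < ε) :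
    |Real.log (C * ε)| ≤ (1 + Real.log C) * (1 + |Real.log ε|) := by
  have hlC : 0 ≤ Real.log C := Real.log_nonneg hC
  rw [Real.log_mul (by linarith) hε.ne']
  have h1 : |Real.log C + Real.log ε| ≤ Real.log C + |Real.log ε| :=
    (abs_add_le _ _).trans (by rw [abs_of_nonneg hlC])
  have h2 : 0 ≤ |Real.log ε| := abs_nonneg _
  nlinarith

/-- A point of the Brillouin box `[-π, π)²` (`bzBox 2 1`) lies in the closed square. [cite: Salmhofer1998, §2.3 (p.6 L142–144)] -/
theorem kltsv_abs_le_pi_of_mem_bzBox {k : Fin 2 → ℝ} (hk : k ∈ bzBox 2 1) (i : Fin 2) : |k i| ≤ π := by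
  have h := (Set.mem_univ_pi.1 hk) i
  rw [div_one] at h
  exact abs_le.2 ⟨h.1, h.2.le⟩

/-- The area of the Brillouin box is `(2π)²`. [cite: Salmhofer1998, §2.3 (p.6 L142–144)] -/
theorem kltsv_volume_bzBox : volume (bzBox 2 1) = ENNReal.ofReal ((2 * π) ^ 2) := by
  rw [bzBox, Real.volume_pi_Ico]
  simp only [div_one, sub_neg_eq_add, Finset.prod_const, Finset.card_univ, Fintype.card_fin]
  rw [← ENNReal.ofReal_pow (by positivity)]
  congr 1; ring

/-! ### §2 The measure-theoretic core: two tubes and an angular constraint -/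

section Core

variable {μ : ℝ} (hμ₁ : -4 < μ) (hμ₂ : μ < 0)
include hμ₁ hμ₂

/-- **Two tubes with an angular constraint.** If every pair `(𝐤₁, 𝐤₂) ∈ S` has `𝐤_j` in the polar tube of half-width `δ_j` and its angle pair
in a measurable `Ang ⊆ ℝ²`, then `vol(S) ≤ (π+δ₁)(2δ₁)·(π+δ₂)(2δ₂)·∫_{θ₁ ∈ (-π,π)} vol{θ₂ ∈ (-π,π) : (θ₁,θ₂) ∈ Ang}` (product of the angular
dominations of part 1). [cite: Salmhofer1998, Lemma 7 proof (6.11)–(6.12) (p.22 L179 – p.23 L10)] -/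
theorem kltsv_volume_le_angular {δ₁ δ₂ : ℝ} (hδ₁ : 0 ≤ δ₁) (hδ₂ : 0 ≤ δ₂) {S : Set ((Fin 2 → ℝ) × (Fin 2 → ℝ))} {Ang : Set (ℝ × ℝ)}
    (hAng : MeasurableSet Ang)
    (hS : ∀ y ∈ S,
      |Real.sqrt (y.1 0 ^ 2 + y.1 1 ^ 2) - bandFermiRadius μ (Complex.arg ((y.1 0 : ℂ) + (y.1 1 : ℂ) * Complex.I))| ≤ δ₁ ∧
      |Real.sqrt (y.2 0 ^ 2 + y.2 1 ^ 2) - bandFermiRadius μ (Complex.arg ((y.2 0 : ℂ) + (y.2 1 : ℂ) * Complex.I))| ≤ δ₂ ∧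
      (Complex.arg ((y.1 0 : ℂ) + (y.1 1 : ℂ) * Complex.I), Complex.arg ((y.2 0 : ℂ) + (y.2 1 : ℂ) * Complex.I)) ∈ Ang) :
    volume S ≤ ENNReal.ofReal ((π + δ₁) * (2 * δ₁)) * (ENNReal.ofReal ((π + δ₂) * (2 * δ₂)) *
      ∫⁻ θ₁ in Ioo (-π) π, volume {θ₂ ∈ Ioo (-π) π | (θ₁, θ₂) ∈ Ang}) := by
  -- notation
  set argR : ℝ × ℝ → ℝ := fun x => Complex.arg ((x.1 : ℂ) + (x.2 : ℂ) * Complex.I) with hargR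
  have hargm : Measurable argR := kltsv_measurable_argR
  set u : ℝ → ℝ := bandFermiRadius μ with hu
  have hucont : Continuous u := continuous_bandFermiRadius hμ₁ hμ₂
  set T : ℝ → Set (ℝ × ℝ) := fun δ => {x | |Real.sqrt (x.1 ^ 2 + x.2 ^ 2) - u (argR x)| ≤ δ} with hT
  have hTm : ∀ δ, MeasurableSet (T δ) := fun δ =>
    measurableSet_le ((kltsv_measurable_radius.sub (hucont.measurable.comp hargm)).abs) measurable_const
  set e : (Fin 2 → ℝ) ≃ᵐ ℝ × ℝ := MeasurableEquiv.finTwoArrow with he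
  have hep : MeasurePreserving e volume volume := volume_preserving_finTwoArrow ℝ
  have hepp : MeasurePreserving (Prod.map e e) volume volume := by
    rw [Measure.volume_eq_prod, Measure.volume_eq_prod]
    exact hep.prod hep
  set W : Set ((ℝ × ℝ) × (ℝ × ℝ)) := (T δ₁ ×ˢ T δ₂) ∩ (Prod.map argR argR) ⁻¹' Ang with hW
  have hpre : MeasurableSet ((Prod.map argR argR) ⁻¹' Ang) := (hargm.prodMap hargm) hAng
  have hWm : MeasurableSet W := ((hTm δ₁).prod (hTm δ₂)).inter hpre
  -- `S` sits in the preimage of `W`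
  have hSW : S ⊆ (Prod.map e e) ⁻¹' W := by
    intro y hy
    obtain ⟨h1, h2, h3⟩ := hS y hy
    have he1 : e y.1 = (y.1 0, y.1 1) := rfl
    have he2 : e y.2 = (y.2 0, y.2 1) := rfl
    refine ⟨⟨?_, ?_⟩, ?_⟩
    · show e y.1 ∈ T δ₁
      rw [he1]; exact h1
    · show e y.2 ∈ T δ₂
      rw [he2]; exact h2
    · show (argR (e y.1), argR (e y.2)) ∈ Ang
      rw [he1, he2]; exact h3
  -- the dominations of part 1
  have hd₁ := kltsv_map_arg_restrict_tube_le hμ₁ hμ₂ hδ₁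
  have hd₂ := kltsv_map_arg_restrict_tube_le hμ₁ hμ₂ hδ₂
  set lam : Measure ℝ := volume.restrict (Ioo (-π) π) with hlam
  set c₁ : ℝ≥0∞ := ENNReal.ofReal ((π + δ₁) * (2 * δ₁)) with hc₁
  set c₂ : ℝ≥0∞ := ENNReal.ofReal ((π + δ₂) * (2 * δ₂)) with hc₂
  -- the volume of `W`
  have hvolW : volume W = ((Measure.map argR (volume.restrict (T δ₁))).prod (Measure.map argR (volume.restrict (T δ₂)))) Ang := by
    rw [Measure.map_prod_map _ _ hargm hargm, Measure.map_apply (hargm.prodMap hargm) hAng, Measure.prod_restrict,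
      Measure.restrict_apply hpre, ← Measure.volume_eq_prod, hW, inter_comm]
  have hprod : ((Measure.map argR (volume.restrict (T δ₁))).prod (Measure.map argR (volume.restrict (T δ₂)))) Ang ≤
      ((c₁ • lam).prod (c₂ • lam)) Ang :=
    (Measure.le_iff'.1 (Measure.prod_mono hd₁ hd₂)) Ang
  have hsmul : ((c₁ • lam).prod (c₂ • lam)) Ang = c₁ * (c₂ * (lam.prod lam) Ang) := by
    rw [Measure.prod_smul_left, Measure.prod_smul_right, Measure.smul_apply, Measure.smul_apply, smul_eq_mul, smul_eq_mul]
  have hll : (lam.prod lam) Ang = ∫⁻ θ₁ in Ioo (-π) π, volume {θ₂ ∈ Ioo (-π) π | (θ₁, θ₂) ∈ Ang} := by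
    rw [Measure.prod_apply hAng, hlam]
    refine lintegral_congr fun θ₁ => ?_
    rw [Measure.restrict_apply (measurable_prodMk_left hAng)]
    congr 1
    ext θ₂
    simp [and_comm]
  calc volume S ≤ volume ((Prod.map e e) ⁻¹' W) := measure_mono hSW
    _ = volume W := hepp.measure_preimage hWm.nullMeasurableSet
    _ = _ := hvolW
    _ ≤ ((c₁ • lam).prod (c₂ • lam)) Ang := hprod
    _ = c₁ * (c₂ * (lam.prod lam) Ang) := hsmul
    _ = _ := by rw [hll]

end Core

/-! ### §3 One shell -/

section Shell

variable {a b : ℝ} (B : BandBounds a b) {μ : ℝ} (hμ : μ ∈ Icc a b)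
include B hμ

/-- **The area of one energy shell**: for `0 ≤ η` with `μ ± η ∈ [a, b]`, `vol{𝐤 ∈ 𝓑 : |ε𝐤 - μ| ≤ η} ≤ (π + δ)(2δ)(2π)`, `δ = √2η/Dt_min`.
[cite: Salmhofer1998, Lemma 7 proof (6.11)–(6.12) (p.22 L179–190)] -/
theorem kltsv_shell_volume_le {η : ℝ} (hη : 0 ≤ η) (hlo : a ≤ μ - η) (hhi : μ + η ≤ b) :
    volume {k : Fin 2 → ℝ | k ∈ bzBox 2 1 ∧ |sqDispersion k - μ| ≤ η} ≤
      ENNReal.ofReal ((π + Real.sqrt 2 * η / B.Dtmin) * (2 * (Real.sqrt 2 * η / B.Dtmin)) * (2 * π)) := by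
  obtain ⟨hμ₁, hμ₂⟩ := B.level hμ
  have hδ : 0 ≤ Real.sqrt 2 * η / B.Dtmin := by have := B.Dtmin_pos; positivity
  set e : (Fin 2 → ℝ) ≃ᵐ ℝ × ℝ := MeasurableEquiv.finTwoArrow with he
  have hep : MeasurePreserving e volume volume := volume_preserving_finTwoArrow ℝ
  set T : Set (ℝ × ℝ) := {x | |Real.sqrt (x.1 ^ 2 + x.2 ^ 2) -
      bandFermiRadius μ (Complex.arg ((x.1 : ℂ) + (x.2 : ℂ) * Complex.I))| ≤ Real.sqrt 2 * η / B.Dtmin} with hT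
  have hTm : MeasurableSet T :=
    measurableSet_le ((kltsv_measurable_radius.sub
      ((continuous_bandFermiRadius hμ₁ hμ₂).measurable.comp kltsv_measurable_argR)).abs) measurable_const
  have hsub : {k : Fin 2 → ℝ | k ∈ bzBox 2 1 ∧ |sqDispersion k - μ| ≤ η} ⊆ e ⁻¹' T := by
    intro k hk
    have h := kltsv_radius_sub_le B hμ (fun i => kltsv_abs_le_pi_of_mem_bzBox hk.1 i) hk.2 hlo hhi
    exact h
  calc volume {k : Fin 2 → ℝ | k ∈ bzBox 2 1 ∧ |sqDispersion k - μ| ≤ η} ≤ volume (e ⁻¹' T) := measure_mono hsub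
    _ = volume T := hep.measure_preimage hTm.nullMeasurableSet
    _ ≤ _ := kltsv_volume_tube_le hμ₁ hμ₂ hδ

end Shell


end Summit.HubbardSuperconductivity.HubbardSuperconductivity.Theorems

end
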